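import Mathlib
import HarnessLib

/-!
# Dwork congruences for the constant terms of powers of a Laurent polynomial
# (Samol–van Straten 2015, Mellit–Vlasenko 2016)

Topic `Literature/NumberTheory/Congruences`, namespace `Literature.NumberTheory.Congruences.DworkCongruences`.

Sources (both read on the page this session, arXiv texts `0911.0797` and `1306.5811`):

* [SamolVanstraten2015] K. Samol, D. van Straten, *Dwork congruences and reflexive polytopes*, Ann. Math.
  Qué. **39** (2015) 185–203 = arXiv:0911.0797. §1 Definition 1: a sequence of integers `a(n)` with `a(0) = 1`
  "satisfies the Dwork congruences" (for the prime `p`) if `a(n)/a(⌊n/p⌋) ∈ ℤ_p` (D1) and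
  `a(n + m p^{s+1})/a(⌊n/p⌋ + m p^s) ≡ a(n)/a(⌊n/p⌋) mod p^{s+1}` (D2); "by cross-multiplication, D2 becomes
  (D3) `a(n + m p^{s+1}) a(⌊n/p⌋) ≡ a(n) a(⌊n/p⌋ + m p^s) mod p^{s+1}`", and "the validity of these congruences is
  implied by those for which `n < p^{s+1}`". §2: for a Laurent polynomial `f = Σ_𝐚 c_𝐚 X^𝐚 ∈ ℤ[X_1^{±1}, …, X_n^{±1}]`,
  `supp(f) = {𝐚 ∈ ℤ^n | c_𝐚 ≠ 0}` and the Newton polyhedron `Δ(f) = convex(supp(f)) ⊂ ℝ^n`. §3 Notation 4: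
  `[f]_0` = the constant term; Definition 5: the fundamental period `Φ(t) = Σ_k a(k) t^k`, `a(k) := [f^k]_0`.
  **Theorem 6.** "Let `f ∈ ℤ[X_1, X_1^{−1}, …, X_n, X_n^{−1}]` with integral coefficients. Assume that the Newton
  polyhedron `Δ(f)` has `0` as its unique interior lattice point. Then the coefficients `a(n) = [f^n]_0` of the
  fundamental period satisfy for each prime number `p` and `s ∈ ℕ` the congruence
  `a(n_0 + ⋯ + n_s p^s) a(n_1 + ⋯ + n_{s−1} p^{s−2}) ≡ a(n_0 + ⋯ + n_{s−1} p^{s−1}) a(n_1 + ⋯ + n_s p^{s−1}) mod p^s`,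
  where `0 ≤ n_i ≤ p − 1` for `0 ≤ i ≤ s − 1`." (The top coefficient `n_s` is an arbitrary non-negative integer;
  with `n := n_0 + ⋯ + n_{s−1} p^{s−1} < p^s` and `m := n_s` this is (D3) at level `s`:
  `a(n + m p^s) a(⌊n/p⌋) ≡ a(n) a(⌊n/p⌋ + m p^{s−1}) mod p^s` — the form typed below.)
* [MellitVlasenko2016] A. Mellit, M. Vlasenko, *Dwork's congruences for the constant terms of powers of a Laurent
  polynomial*, Int. J. Number Theory **12** (2016) 313–321 = arXiv:1306.5811. **Theorem 1.** "Let
  `Λ(x) ∈ ℤ_p[x_1^{±1}, …, x_d^{±1}]` be a Laurent polynomial, and consider the sequence of the constant terms of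
  powers of `Λ`, `b_n = [Λ(x)^n]_0`, `n = 0, 1, 2, …`. Define `f(X) = Σ_{n≥0} b_n X^n` and
  `f_s(X) = Σ_{n=0}^{p^s − 1} b_n X^n`, `s = 0, 1, 2, …`. If the Newton polyhedron of `Λ` contains the origin as its
  only interior integral point, then for every `s ≥ 1` one has the congruence
  (1) `f(X)/f(X^p) ≡ f_s(X)/f_{s−1}(X^p) mod p^s ℤ_p[[X]]`, or, equivalently, for every `s ≥ 1`
  (2) `f_{s+1}(X) f_{s−1}(X^p) ≡ f_s(X) f_s(X^p) mod p^s ℤ_p[X]`." §1 also restates (D3) as display (dig2)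
  ("In [SvS09] … under the same assumptions as in Theorem 1 one has
  `b_{n + m p^s} b_{⌊n/p⌋} ≡ b_n b_{⌊n/p⌋ + m p^{s−1}} mod p^s` for all `n, m ≥ 0`, `s ≥ 1`. We do not know whether
  it is possible to deduce congruences (1)–(2) from (dig2). Our method of proof is independent and actually allows
  one to get (dig2) as a byproduct."), and **Lemma 1**: "Under the assumptions of Theorem 1, there exists a
  `ℤ_p`-valued sequence `{c_n ; n ≥ 0}` such that for all `n ≥ 1`
  (A1) `b_n = Σ_{n = n^{(1)} * ⋯ * n^{(r)}} c_{n^{(1)}} ⋯ c_{n^{(r)}}`, where the sum runs over all `1 ≤ r ≤ ℓ(n)` and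
  all possible partitions of the expansion of `n` to the base `p` into `r` expansions of non-negative integers, and
  (A2) `c_n ≡ 0 mod p^{ℓ(n) − 1}`." Here (§1) `ℓ(n) = ⌊log n / log p⌋ + 1` is the length of the base-`p` expansion of
  `n`, `ℓ(0) = 1`, and `n^{(1)} * ⋯ * n^{(r)} := n^{(1)} + n^{(2)} p^{ℓ(n^{(1)})} + ⋯` is the number whose expansion is
  the concatenation of the expansions of the `n^{(i)}` (so a block `n^{(i)}` of the digit string of `n` is either the
  single digit `0` or ends in a non-zero digit).

## What this file contains

* VOCABULARY (definitions with bodies): `LaurentPoly R d = AddMonoidAlgebra R (Fin d → ℤ)` (Laurent polynomials in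
  `d` variables), `constTerm`, `ctPow Λ n = [Λ^n]_0` (the sequence `b_n` / `a(n)`), the lattice embedding
  `latticeEmb : ℤ^d →+ ℝ^d`, `newtonPolytope Λ = convexHull ℝ (supp Λ) ⊂ ℝ^d`, the hypothesis
  `OriginUniqueInteriorLatticePoint Λ` ("the Newton polyhedron contains the origin as its only interior integral
  point"; TYPED with the topological interior in `ℝ^d`, so it presupposes a full-dimensional Newton polytope — the
  papers' standing situation; a relative-interior variant is NOT typed), the truncations
  `truncGF Λ p s = f_s(X) = Σ_{n < p^s} b_n X^n ∈ R[X]`, the digit length `len p n = ℓ(n)` and the block predicate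
  `BlockValid p n j` ("the lowest `j` digits of `n` form a block of the kind summed over in (A1)", i.e. `j = 1` or
  the digit of `p^{j−1}` is non-zero).
* NAMED FACTS (statements as printed, D-0014): `samolVanStraten2015_theorem6` ([SamolVanstraten2015, Thm. 6] =
  [MellitVlasenko2016, §1 (dig2)], integer coefficients, the (D3) form) and `mellitVlasenko2016_theorem1`
  ([MellitVlasenko2016, Thm. 1 (2)], `ℤ_p` coefficients, the polynomial form (2)).
* PROVED here: **`dwork_congruence_of_blockRecursion`** — the elementary heart of "the reader could deduce
  congruences (dig2) from Lemma 1 in a similar way" [MellitVlasenko2016, end of §5]: ANY sequence `b` over a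
  commutative ring admitting a "first-block" recursion
  `b(n) = Σ_{j=1}^{ℓ(n)} [BlockValid p n j] c(n mod p^j) b(⌊n/p^j⌋)` (the recursive form of (A1): split off the
  first block `n^{(1)} = n mod p^j` of a partition) with `p^{ℓ(k)−1} ∣ c(k)` (A2) satisfies (D3) for every `s ≥ 1`
  and all `n, m`. The proof is a double induction (on `s`, then on the length `j` of a common digit prefix `w`) of
  the statement `u ≡ v mod p^{s−1} ⇒ b(w + p^j u) b(v) ≡ b(w + p^j v) b(u) mod p^s`; it is this seat's own
  write-up of the deduction the source leaves to the reader (the source proves the polynomial form (2) instead, by a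
  bijection between "good pairs of partitions", §5). The sibling file `DworkCongruencesGhostTerms.lean` constructs
  `c_n = [I_Λ^n]_0` by the ghost-term expansion of [MellitVlasenko2016, §§2–4] and discharges
  `samolVanStraten2015_theorem6`.

Deliberately NOT here: (D1) (`a(n)/a(⌊n/p⌋) ∈ ℤ_p`, [SamolVanstraten2015, §7], which needs `p`-adic estimates of
the `g_{n,i}` and is not claimed in Theorem 6); Dwork's analytic-continuation Lemma 2 of [MellitVlasenko2016]
(= [SamolVanstraten2015, Thm. 2]); the unit-root application; reflexive polytopes.
-/

noncomputable section

open Finset Polynomial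

namespace Literature.NumberTheory.Congruences.DworkCongruences

/-! ## Laurent polynomials in `d` variables, constant terms, Newton polytope -/

/-- Laurent polynomials in `d` (commuting) variables over `R`: the additive monoid algebra of the lattice `ℤ^d`
(`x^𝐮 = single 𝐮 1`). [cite: SamolVanstraten2015, §2 (Laurent polynomials, multi-index notation)] -/
abbrev LaurentPoly (R : Type*) [CommRing R] (d : ℕ) : Type _ := AddMonoidAlgebra R (Fin d → ℤ)

variable {R : Type*} [CommRing R] {d : ℕ}

/-- The constant term `[Φ]_0` of a Laurent polynomial (the coefficient of the monomial `X^0`).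
[cite: SamolVanstraten2015, §3 Notation 4] -/
def constTerm (Φ : LaurentPoly R d) : R := Φ.coeff 0

/-- The sequence `b_n = a(n) = [Λ^n]_0` of constant terms of the powers of `Λ` (the coefficients of the
fundamental period `Φ(t) = Σ_n a(n) t^n`). [cite: SamolVanstraten2015, §3 Definition 5] -/
def ctPow (Λ : LaurentPoly R d) (n : ℕ) : R := constTerm (Λ ^ n)

/-- The embedding of the exponent lattice `ℤ^d` into `ℝ^d`. [cite: SamolVanstraten2015, §2 (`supp(f) ⊂ ℤ^n`,
`Δ(f) ⊂ ℝ^n`)] -/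
def latticeEmb (d : ℕ) : (Fin d → ℤ) →+ (Fin d → ℝ) := (Int.castAddHom ℝ).compLeft (Fin d)

/-- The Newton polyhedron `Δ(Λ) ⊂ ℝ^d`: the convex hull of the support (the set of exponent vectors of the
monomials of `Λ`). [cite: SamolVanstraten2015, §2 (`Δ(f) := convex(supp(f))`)] -/
def newtonPolytope (Λ : LaurentPoly R d) : Set (Fin d → ℝ) :=
  convexHull ℝ (latticeEmb d '' (Λ.coeff.support : Set (Fin d → ℤ)))

/-- HYPOTHESIS "the Newton polyhedron of `Λ` contains the origin as its only interior integral point": `0` is an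
interior point of `Δ(Λ)` (interior taken in `ℝ^d`) and every lattice point in the interior of `Δ(Λ)` is `0`.
[cite: MellitVlasenko2016, Thm. 1 (hypothesis); SamolVanstraten2015, Thm. 6 (hypothesis)] -/
def OriginUniqueInteriorLatticePoint (Λ : LaurentPoly R d) : Prop :=
  (0 : Fin d → ℝ) ∈ interior (newtonPolytope Λ) ∧
    ∀ u : Fin d → ℤ, latticeEmb d u ∈ interior (newtonPolytope Λ) → u = 0

/-- The truncated generating polynomial `f_s(X) = Σ_{n=0}^{p^s − 1} b_n X^n ∈ R[X]`.
[cite: MellitVlasenko2016, Thm. 1 (`f_s`)] -/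
def truncGF (Λ : LaurentPoly R d) (p s : ℕ) : R[X] :=
  ∑ n ∈ range (p ^ s), C (ctPow Λ n) * X ^ n

/-! ## The two published theorems, as named facts -/

/-- **Samol–van Straten 2015, Theorem 6** (= [MellitVlasenko2016, §1 (dig2)], the Dwork congruence (D3)).
For `f ∈ ℤ[X_1^{±1}, …, X_d^{±1}]` whose Newton polyhedron has `0` as its unique interior lattice point,
`a(n) = [f^n]_0`, every prime `p`, every `s ≥ 1`, every `n = n_0 + ⋯ + n_{s−1} p^{s−1} < p^s` and every `m = n_s ≥ 0`:
`a(n + m p^s) · a(⌊n/p⌋) ≡ a(n) · a(⌊n/p⌋ + m p^{s−1}) (mod p^s)`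
(printed in digits: `a(n_0 + ⋯ + n_s p^s) a(n_1 + ⋯ + n_{s−1}p^{s−2}) ≡ a(n_0 + ⋯ + n_{s−1}p^{s−1}) a(n_1 + ⋯ + n_s p^{s−1})
mod p^s`). Discharged in `DworkCongruencesGhostTerms.lean`. [cite: SamolVanstraten2015, Thm. 6] -/
def samolVanStraten2015_theorem6 : Prop :=
  ∀ (d : ℕ) (Λ : LaurentPoly ℤ d), OriginUniqueInteriorLatticePoint Λ →
    ∀ p : ℕ, p.Prime → ∀ s : ℕ, 1 ≤ s → ∀ n m : ℕ, n < p ^ s →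
      ctPow Λ (n + m * p ^ s) * ctPow Λ (n / p) ≡
        ctPow Λ n * ctPow Λ (n / p + m * p ^ (s - 1)) [ZMOD (p : ℤ) ^ s]

/-- **Mellit–Vlasenko 2016, Theorem 1** (polynomial form (2)). For `Λ ∈ ℤ_p[x_1^{±1}, …, x_d^{±1}]` whose Newton
polyhedron contains the origin as its only interior integral point and `f_s(X) = Σ_{n < p^s} [Λ^n]_0 X^n`:
for every `s ≥ 1`, `f_{s+1}(X) f_{s−1}(X^p) ≡ f_s(X) f_s(X^p) mod p^s ℤ_p[X]` (equivalently (1):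
`f(X)/f(X^p) ≡ f_s(X)/f_{s−1}(X^p) mod p^s ℤ_p[[X]]`). Named fact (statement only; the printed proof is the
bijection of "good pairs of partitions" of §5). [cite: MellitVlasenko2016, Thm. 1 (2)] -/
def mellitVlasenko2016_theorem1 : Prop :=
  ∀ (p : ℕ) [Fact p.Prime] (d : ℕ) (Λ : LaurentPoly ℤ_[p] d), OriginUniqueInteriorLatticePoint Λ →
    ∀ s : ℕ, 1 ≤ s →
      (p : ℤ_[p][X]) ^ s ∣
        truncGF Λ p (s + 1) * expand ℤ_[p] p (truncGF Λ p (s - 1)) -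
          truncGF Λ p s * expand ℤ_[p] p (truncGF Λ p s)

/-! ## Base-`p` digit strings: length `ℓ(n)` and blocks -/

/-- `ℓ(n) = ⌊log n / log p⌋ + 1`, the number of base-`p` digits of `n`, with `ℓ(0) = 1`.
[cite: MellitVlasenko2016, §1 (notation `ℓ(n)`)] -/
def len (p n : ℕ) : ℕ := Nat.log p n + 1

/-- `BlockValid p n j`: the lowest `j` digits of `n` are the expansion of a number of length exactly `j`, i.e.
`j = 1` or the digit of `p^{j−1}` in `n` is non-zero — these are the admissible first blocks `n^{(1)} = n mod p^j` of a
partition `n = n^{(1)} * ⋯ * n^{(r)}` of the digit string of `n`. [cite: MellitVlasenko2016, §1 (notation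
`n^{(1)} * ⋯ * n^{(r)}`)] -/
abbrev BlockValid (p n j : ℕ) : Prop := j = 1 ∨ n / p ^ (j - 1) % p ≠ 0

variable {p : ℕ}

/-- `n < p^{ℓ(n)}`. [cite: MellitVlasenko2016, §1 (notation `ℓ(n)`)] -/
theorem lt_pow_len (hp : 1 < p) (n : ℕ) : n < p ^ len p n := Nat.lt_pow_succ_log_self hp n

/-- `p^{ℓ(n)−1} ≤ n` for `n ≠ 0`. [cite: MellitVlasenko2016, §1 (notation `ℓ(n)`)] -/
theorem pow_len_sub_one_le {n : ℕ} (hn : n ≠ 0) : p ^ (len p n - 1) ≤ n := by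
  simpa [len] using Nat.pow_log_le_self p hn

/-- `ℓ(n) ≤ k ↔ n < p^k` (for `k ≥ 1`). [cite: MellitVlasenko2016, §1 (notation `ℓ(n)`)] -/
theorem len_le_iff (hp : 1 < p) {n k : ℕ} (hk : k ≠ 0) : len p n ≤ k ↔ n < p ^ k :=
  ⟨fun h => (lt_pow_len hp n).trans_le (Nat.pow_le_pow_right (by omega) h),
   fun h => Nat.log_lt_of_lt_pow' hk h⟩

/-- `k ≤ ℓ(n) ↔ p^{k−1} ≤ n` for `n ≠ 0`. [cite: MellitVlasenko2016, §1 (notation `ℓ(n)`)] -/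
theorem le_len_iff (hp : 1 < p) {n k : ℕ} (hn : n ≠ 0) : k ≤ len p n ↔ p ^ (k - 1) ≤ n := by
  rw [← Nat.le_log_iff_pow_le hp hn, len]; omega

/-- The length of a number with a non-zero digit at position `i` is at least `i + 1`.
[cite: MellitVlasenko2016, §1 (notation `ℓ(n)`)] -/
theorem succ_le_len_of_digit_ne_zero (hp : 1 < p) {n i : ℕ} (h : n / p ^ i % p ≠ 0) : i + 1 ≤ len p n := by
  have hn : n ≠ 0 := by rintro rfl; simp at h
  rw [le_len_iff hp hn, Nat.add_sub_cancel]
  by_contra hlt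
  exact h (by rw [Nat.div_eq_of_lt (lt_of_not_ge hlt), Nat.zero_mod])

/-- Digits beyond the length vanish: `ℓ(n) ≤ i ⇒ ⌊n/p^i⌋ = 0`. [cite: MellitVlasenko2016, §1 (notation `ℓ(n)`)] -/
theorem div_pow_eq_zero_of_len_le (hp : 1 < p) {n i : ℕ} (h : len p n ≤ i) : n / p ^ i = 0 :=
  Nat.div_eq_of_lt ((lt_pow_len hp n).trans_le (Nat.pow_le_pow_right (by omega) h))

/-- No admissible block is longer than the digit string: `ℓ(n) < j ⇒ ¬ BlockValid p n j`.
[cite: MellitVlasenko2016, §1 (notation `n^{(1)} * ⋯ * n^{(r)}`)] -/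
theorem not_blockValid_of_len_lt (hp : 1 < p) {n j : ℕ} (hj : len p n < j) : ¬ BlockValid p n j := by
  rintro (h | h)
  · simp [len] at hj; omega
  · exact h (by rw [div_pow_eq_zero_of_len_le hp (by omega), Nat.zero_mod])

/-- An admissible block of length `j ≥ 1` cut from `n` is a number of length exactly `j`:
`BlockValid p n j ⇒ ℓ(n mod p^j) = j`. [cite: MellitVlasenko2016, §1 (notation `n^{(1)} * ⋯ * n^{(r)}`)] -/
theorem len_mod_pow_of_blockValid (hp : 1 < p) {n j : ℕ} (hj : 1 ≤ j) (h : BlockValid p n j) :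
    len p (n % p ^ j) = j := by
  apply le_antisymm
  · exact (len_le_iff hp (by omega)).2 (Nat.mod_lt _ (by positivity))
  · rcases h with rfl | h
    · simp [len]
    · obtain ⟨i, rfl⟩ : ∃ i, j = i + 1 := ⟨j - 1, by omega⟩
      apply succ_le_len_of_digit_ne_zero hp (i := i)
      rwa [Nat.add_sub_cancel, Nat.pow_succ, Nat.mod_mul_right_div_self, Nat.mod_mod] at *

/-! ## From the first-block recursion (A1)–(A2) to the Dwork congruence (D3) -/

section BlockRecursion

variable {b c : ℕ → R}

/-- The recursion may be summed up to any bound `K ≥ ℓ(N)`: the extra blocks are inadmissible.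
[cite: MellitVlasenko2016, Lemma 1 (A1)] -/
theorem blockRecursion_ext (hp : 1 < p)
    (hrec : ∀ n, b n = ∑ j ∈ Icc 1 (len p n),
      if BlockValid p n j then c (n % p ^ j) * b (n / p ^ j) else 0)
    {N K : ℕ} (hK : len p N ≤ K) :
    b N = ∑ j ∈ Icc 1 K, if BlockValid p N j then c (N % p ^ j) * b (N / p ^ j) else 0 := by
  rw [hrec N]
  refine Finset.sum_subset (Icc_subset_Icc_right hK) fun j hj hj' => ?_
  have : len p N < j := by simp only [mem_Icc] at hj hj'; omega
  simp [not_blockValid_of_len_lt hp this]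

/-- `Σ_{j ∈ [1, J+K]} F j = Σ_{j ∈ [1, J]} F j + Σ_{k ∈ [1, K]} F (J + k)`. [folklore] -/
private theorem sum_Icc_one_add (F : ℕ → R) (J K : ℕ) :
    ∑ j ∈ Icc 1 (J + K), F j = ∑ j ∈ Icc 1 J, F j + ∑ k ∈ Icc 1 K, F (J + k) := by
  induction K with
  | zero => simp
  | succ K ih =>
    rw [← add_assoc, Finset.sum_Icc_succ_top (by omega), ih, Finset.sum_Icc_succ_top (by omega), add_assoc,
      add_assoc]

/-- Digits of `w + p^j u` below position `j` are those of `w` (`w < p^j`): quotient form.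
[cite: MellitVlasenko2016, §1 (notation `n^{(1)} * ⋯ * n^{(r)}`)] -/
theorem prefix_div (hp : 1 < p) {w j u i : ℕ} (hi : i ≤ j) :
    (w + p ^ j * u) / p ^ i = w / p ^ i + p ^ (j - i) * u := by
  have h0 : 0 < p ^ i := pow_pos (by omega) _
  obtain ⟨t, rfl⟩ := Nat.exists_eq_add_of_le hi
  rw [show p ^ (i + t) * u = (p ^ t * u) * p ^ i by ring, Nat.add_mul_div_right _ _ h0,
    Nat.add_sub_cancel_left]

/-- Digits of `w + p^j u` below position `j` are those of `w` (`w < p^j`): digit form (`i < j`).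
[cite: MellitVlasenko2016, §1 (notation `n^{(1)} * ⋯ * n^{(r)}`)] -/
theorem prefix_digit (hp : 1 < p) {w j u i : ℕ} (hi : i < j) :
    (w + p ^ j * u) / p ^ i % p = w / p ^ i % p := by
  rw [prefix_div hp hi.le]
  obtain ⟨t, ht⟩ := Nat.exists_eq_add_of_lt hi
  rw [ht, show i + t + 1 - i = t + 1 by omega, pow_succ,
    show w / p ^ i + p ^ t * p * u = w / p ^ i + (p ^ t * u) * p by ring, Nat.add_mul_mod_self_right]

/-- `(w + p^j u) mod p^i = w mod p^i` for `i ≤ j`. [cite: MellitVlasenko2016, §1 (notation `n^{(1)} * ⋯ * n^{(r)}`)] -/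
theorem prefix_mod {w j u i : ℕ} (hi : i ≤ j) :
    (w + p ^ j * u) % p ^ i = w % p ^ i := by
  obtain ⟨t, rfl⟩ := Nat.exists_eq_add_of_le hi
  rw [show p ^ (i + t) * u = (p ^ t * u) * p ^ i by ring, Nat.add_mul_mod_self_right]

/-- Digits of `w + p^j u` from position `j` on are those of `u` (`w < p^j`): quotient form.
[cite: MellitVlasenko2016, §1 (notation `n^{(1)} * ⋯ * n^{(r)}`)] -/
theorem suffix_div (hp : 1 < p) {w j u : ℕ} (hw : w < p ^ j) (k : ℕ) :
    (w + p ^ j * u) / p ^ (j + k) = u / p ^ k := by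
  have h0 : 0 < p ^ j := pow_pos (by omega) _
  rw [pow_add, ← Nat.div_div_eq_div_mul, show p ^ j * u = u * p ^ j by ring, Nat.add_mul_div_right _ _ h0,
    Nat.div_eq_of_lt hw, zero_add]

/-- Digits of `w + p^j u` from position `j` on are those of `u` (`w < p^j`): digit form.
[cite: MellitVlasenko2016, §1 (notation `n^{(1)} * ⋯ * n^{(r)}`)] -/
theorem suffix_digit (hp : 1 < p) {w j u : ℕ} (hw : w < p ^ j) (k : ℕ) :
    (w + p ^ j * u) / p ^ (j + k) % p = u / p ^ k % p := by
  rw [suffix_div hp hw]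

/-- `(w + p^j u) mod p^{j+k} = w + p^j (u mod p^k)` (`w < p^j`).
[cite: MellitVlasenko2016, §1 (notation `n^{(1)} * ⋯ * n^{(r)}`)] -/
theorem suffix_mod (hp : 1 < p) {w j u : ℕ} (hw : w < p ^ j) (k : ℕ) :
    (w + p ^ j * u) % p ^ (j + k) = w + p ^ j * (u % p ^ k) := by
  have h0 : 0 < p ^ j := pow_pos (by omega) _
  rw [pow_add, Nat.mod_mul, show p ^ j * u = u * p ^ j by ring, Nat.add_mul_mod_self_right,
    Nat.add_mul_div_right _ _ h0, Nat.div_eq_of_lt hw, zero_add, Nat.mod_eq_of_lt hw]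

/-- A block of length `j + k` cut from `w + p^j u` (`w < p^j`) whose top digit — the digit of `u` at
position `k − 1` — is non-zero is a number of length `j + k`, so (A2) gives `p^{j+k−1} ∣ c`.
[cite: MellitVlasenko2016, Lemma 1 (A2)] -/
theorem pow_dvd_c_block (hp : 1 < p) (hc : ∀ k, (p : R) ^ (len p k - 1) ∣ c k)
    {w j u k : ℕ} (hw : w < p ^ j) (hk : 1 ≤ k) (hd : u / p ^ (k - 1) % p ≠ 0) :
    (p : R) ^ (j + k - 1) ∣ c (w + p ^ j * (u % p ^ k)) := by
  refine (pow_dvd_pow (p : R) ?_).trans (hc _)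
  obtain ⟨i, rfl⟩ : ∃ i, k = i + 1 := ⟨k - 1, by omega⟩
  have hdig : (w + p ^ j * (u % p ^ (i + 1))) / p ^ (j + i) % p ≠ 0 := by
    rw [suffix_digit hp hw, pow_succ, Nat.mod_mul_right_div_self, Nat.mod_mod]
    simpa using hd
  have := succ_le_len_of_digit_ne_zero hp hdig
  omega

/-- Congruent numbers have the same low digits: `u ≡ v mod p^k ⇒` the digits at position `k − 1` agree.
[cite: MellitVlasenko2016, §1 (notation `ℓ(n)`)] -/
theorem digit_eq_of_modEq {u v k : ℕ} (hk : 1 ≤ k) (h : u ≡ v [MOD p ^ k]) :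
    u / p ^ (k - 1) % p = v / p ^ (k - 1) % p := by
  obtain ⟨i, rfl⟩ : ∃ i, k = i + 1 := ⟨k - 1, by omega⟩
  rw [Nat.add_sub_cancel, ← Nat.mod_mul_right_div_self, ← Nat.mod_mul_right_div_self v, ← pow_succ]
  exact congrArg (· / p ^ i) h

/-- `u ≡ v mod p^{k+m} ⇒ ⌊u/p^k⌋ ≡ ⌊v/p^k⌋ mod p^m`. [cite: MellitVlasenko2016, §1 (notation `ℓ(n)`)] -/
theorem div_modEq_of_modEq {u v k m : ℕ} (h : u ≡ v [MOD p ^ (k + m)]) :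
    u / p ^ k ≡ v / p ^ k [MOD p ^ m] := by
  unfold Nat.ModEq at h ⊢
  rw [← Nat.mod_mul_right_div_self, ← Nat.mod_mul_right_div_self v, ← pow_add, h]

/-- The statement `D(s, j)` proved by double induction: for a common digit prefix `w < p^j` and
`u ≡ v mod p^{s−1}`, `p^s ∣ b(w + p^j u) b(v) − b(w + p^j v) b(u)`. For `j = 1` this is (D3) = (dig2).
[cite: MellitVlasenko2016, §1 (dig2)] -/
def PrefixCongr (p : ℕ) (b : ℕ → R) (s j : ℕ) : Prop :=
  ∀ w u v : ℕ, w < p ^ j → u ≡ v [MOD p ^ (s - 1)] →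
    (p : R) ^ s ∣ b (w + p ^ j * u) * b v - b (w + p ^ j * v) * b u

/-- **From the first-block recursion to the Dwork congruences** (prefix form). If
`b(n) = Σ_{j=1}^{ℓ(n)} [BlockValid p n j] c(n mod p^j) b(⌊n/p^j⌋)` for all `n` (the recursive form of (A1)) and
`p^{ℓ(k)−1} ∣ c(k)` for all `k` (A2), then `D(s, j)` holds for all `s ≥ 1` and all `j`.
[cite: MellitVlasenko2016, Lemma 1 and §5 ("The reader could deduce congruences (dig2) from Lemma 1 in a similar way")] -/
theorem prefixCongr_of_blockRecursion (hp : 1 < p)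
    (hrec : ∀ n, b n = ∑ j ∈ Icc 1 (len p n),
      if BlockValid p n j then c (n % p ^ j) * b (n / p ^ j) else 0)
    (hc : ∀ k, (p : R) ^ (len p k - 1) ∣ c k) :
    ∀ s, 1 ≤ s → ∀ j, PrefixCongr p b s j := by
  intro s
  induction s using Nat.strong_induction_on with
  | _ s IHs =>
  intro hs j
  induction j using Nat.strong_induction_on with
  | _ j IHj =>
  intro w u v hw huv
  rcases Nat.eq_zero_or_pos j with rfl | hj
  · have hw0 : w = 0 := by simpa using hw
    subst hw0
    simp only [pow_zero, one_mul, zero_add]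
    exact ⟨0, by ring⟩
  -- the length bound used to expand both `b (w + p^j u)` and `b (w + p^j v)` up to `j + K`
  set K := len p u + len p v with hK
  have hlenN : ∀ x, len p x ≤ K → len p (w + p ^ j * x) ≤ j + K := by
    intro x hx
    rw [len_le_iff hp (by omega)]
    have hxl : x < p ^ K := (lt_pow_len hp x).trans_le (Nat.pow_le_pow_right (by omega) hx)
    calc w + p ^ j * x < p ^ j + p ^ j * x := by omega
      _ = p ^ j * (x + 1) := by ring
      _ ≤ p ^ j * p ^ K := Nat.mul_le_mul_left _ (by omega)
      _ = p ^ (j + K) := (pow_add _ _ _).symm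
  have hp0 : 0 < p := by omega
  -- expansions of `b (w + p^j x)`: prefix blocks (`j' ≤ j`) and suffix blocks (`j + k`)
  have hexp : ∀ x, len p x ≤ K → b (w + p ^ j * x) =
      (∑ j' ∈ Icc 1 j, if BlockValid p w j' then c (w % p ^ j') * b (w / p ^ j' + p ^ (j - j') * x) else 0) +
      ∑ k ∈ Icc 1 K, if x / p ^ (k - 1) % p ≠ 0 then c (w + p ^ j * (x % p ^ k)) * b (x / p ^ k) else 0 := by
    intro x hx
    rw [blockRecursion_ext hp hrec (hlenN x hx), sum_Icc_one_add]
    congr 1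
    · refine Finset.sum_congr rfl fun j' hj' => ?_
      simp only [mem_Icc] at hj'
      have h1 : (w + p ^ j * x) / p ^ (j' - 1) % p = w / p ^ (j' - 1) % p := prefix_digit hp (by omega)
      have h2 : (w + p ^ j * x) % p ^ j' = w % p ^ j' := prefix_mod hj'.2
      have h3 : (w + p ^ j * x) / p ^ j' = w / p ^ j' + p ^ (j - j') * x := prefix_div hp hj'.2
      simp only [BlockValid, h1, h2, h3]
    · refine Finset.sum_congr rfl fun k hk => ?_
      simp only [mem_Icc] at hk
      have h1 : (w + p ^ j * x) / p ^ (j + k - 1) % p = x / p ^ (k - 1) % p := by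
        rw [show j + k - 1 = j + (k - 1) by omega, suffix_digit hp hw]
      have h2 : (w + p ^ j * x) % p ^ (j + k) = w + p ^ j * (x % p ^ k) := suffix_mod hp hw k
      have h3 : (w + p ^ j * x) / p ^ (j + k) = x / p ^ k := suffix_div hp hw k
      have h4 : ¬ (j + k = 1) := by omega
      simp only [BlockValid, h1, h2, h3, h4, false_or]
  rw [hexp u (by omega), hexp v (by omega)]
  -- split the difference into the prefix part and the suffix part
  have key : ∀ (A₁ B₁ A₂ B₂ : R), (A₁ + B₁) * b v - (A₂ + B₂) * b u =
      (A₁ * b v - A₂ * b u) + (B₁ * b v - B₂ * b u) := by intros; ring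
  rw [key]
  refine dvd_add ?_ ?_
  · -- prefix part: inner induction hypothesis at prefix length `j - j' < j`
    rw [Finset.sum_mul, Finset.sum_mul, ← Finset.sum_sub_distrib]
    refine Finset.dvd_sum fun j' hj' => ?_
    simp only [mem_Icc] at hj'
    by_cases hV : BlockValid p w j'
    · rw [if_pos hV, if_pos hV]
      have hw' : w / p ^ j' < p ^ (j - j') := by
        rw [Nat.div_lt_iff_lt_mul (by positivity), ← pow_add, show j - j' + j' = j by omega]
        exact hw
      have := IHj (j - j') (by omega) (w / p ^ j') u v hw' huv
      rw [show c (w % p ^ j') * b (w / p ^ j' + p ^ (j - j') * u) * b v -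
          c (w % p ^ j') * b (w / p ^ j' + p ^ (j - j') * v) * b u =
          c (w % p ^ j') * (b (w / p ^ j' + p ^ (j - j') * u) * b v -
            b (w / p ^ j' + p ^ (j - j') * v) * b u) by ring]
      exact dvd_mul_of_dvd_right this _
    · rw [if_neg hV, if_neg hV]; simp
  · -- suffix part: blocks straddling position `j`, of length `j + k`
    rw [Finset.sum_mul, Finset.sum_mul, ← Finset.sum_sub_distrib]
    refine Finset.dvd_sum fun k hk => ?_
    simp only [mem_Icc] at hk
    by_cases hks : k < s
    · -- `k ≤ s - 1`: the two blocks coincide; outer induction hypothesis at level `s - k < s`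
      have hmodk : u ≡ v [MOD p ^ k] := huv.of_dvd (pow_dvd_pow p (by omega))
      have hdig : u / p ^ (k - 1) % p = v / p ^ (k - 1) % p := digit_eq_of_modEq hk.1 hmodk
      have hmk : u % p ^ k = v % p ^ k := hmodk
      by_cases hd : u / p ^ (k - 1) % p ≠ 0
      · have hdv : v / p ^ (k - 1) % p ≠ 0 := hdig ▸ hd
        rw [if_pos hd, if_pos hdv]
        -- rewrite `b u`, `b v` through the common low part `x = u mod p^k = v mod p^k`
        have hu' : b u = b (v % p ^ k + p ^ k * (u / p ^ k)) := by rw [← hmk, Nat.mod_add_div]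
        have hv' : b v = b (v % p ^ k + p ^ k * (v / p ^ k)) := by rw [Nat.mod_add_div]
        rw [hu', hv', hmk]
        have hγ : (p : R) ^ (j + k - 1) ∣ c (w + p ^ j * (v % p ^ k)) := by
          rw [← hmk]; exact pow_dvd_c_block hp hc hw hk.1 hd
        have hIH : (p : R) ^ (s - k) ∣ b (v % p ^ k + p ^ k * (u / p ^ k)) * b (v / p ^ k) -
            b (v % p ^ k + p ^ k * (v / p ^ k)) * b (u / p ^ k) := by
          refine IHs (s - k) (by omega) (by omega) k (v % p ^ k) (u / p ^ k) (v / p ^ k)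
            (Nat.mod_lt _ (by positivity)) ?_
          apply div_modEq_of_modEq
          rwa [show k + (s - k - 1) = s - 1 by omega]
        have hprod := mul_dvd_mul hγ hIH
        rw [← pow_add] at hprod
        refine (pow_dvd_pow (p : R) (by omega : s ≤ j + k - 1 + (s - k))).trans ?_
        rw [show c (w + p ^ j * (v % p ^ k)) * b (u / p ^ k) * b (v % p ^ k + p ^ k * (v / p ^ k)) -
            c (w + p ^ j * (v % p ^ k)) * b (v / p ^ k) * b (v % p ^ k + p ^ k * (u / p ^ k)) =
            -(c (w + p ^ j * (v % p ^ k)) * (b (v % p ^ k + p ^ k * (u / p ^ k)) * b (v / p ^ k) -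
              b (v % p ^ k + p ^ k * (v / p ^ k)) * b (u / p ^ k))) by ring]
        exact (dvd_neg).2 hprod
      · have hdv : ¬ (v / p ^ (k - 1) % p ≠ 0) := hdig ▸ hd
        rw [if_neg hd, if_neg hdv]; simp
    · -- `k ≥ s`: each block separately is `≡ 0 mod p^s` by (A2)
      refine dvd_sub ?_ ?_
      · by_cases hd : u / p ^ (k - 1) % p ≠ 0
        · rw [if_pos hd]
          have hγ := pow_dvd_c_block (R := R) (w := w) (j := j) hp hc hw hk.1 hd
          exact dvd_mul_of_dvd_left (dvd_mul_of_dvd_left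
            ((pow_dvd_pow (p : R) (by omega : s ≤ j + k - 1)).trans hγ) _) _
        · rw [if_neg hd]; simp
      · by_cases hd : v / p ^ (k - 1) % p ≠ 0
        · rw [if_pos hd]
          have hγ := pow_dvd_c_block (R := R) (w := w) (j := j) hp hc hw hk.1 hd
          exact dvd_mul_of_dvd_left (dvd_mul_of_dvd_left
            ((pow_dvd_pow (p : R) (by omega : s ≤ j + k - 1)).trans hγ) _) _
        · rw [if_neg hd]; simp

/-- **Dwork congruence (D3) from the first-block recursion.** If a sequence `b : ℕ → R` satisfies
`b(n) = Σ_{j=1}^{ℓ(n)} [BlockValid p n j] c(n mod p^j) b(⌊n/p^j⌋)` for all `n` with `p^{ℓ(k)−1} ∣ c(k)` for all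
`k` — which is what [MellitVlasenko2016, Lemma 1] provides for `b_n = [Λ^n]_0`, `c_n = [I_Λ^n]_0` — then for
every `s ≥ 1` and all `n, m ≥ 0`: `p^s ∣ b(n + m p^s) b(⌊n/p⌋) − b(n) b(⌊n/p⌋ + m p^{s−1})`.
[cite: MellitVlasenko2016, §1 (dig2) and §5 (last sentence); SamolVanstraten2015, §1 (D3)] -/
theorem dwork_congruence_of_blockRecursion (hp : 1 < p)
    (hrec : ∀ n, b n = ∑ j ∈ Icc 1 (len p n),
      if BlockValid p n j then c (n % p ^ j) * b (n / p ^ j) else 0)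
    (hc : ∀ k, (p : R) ^ (len p k - 1) ∣ c k) {s : ℕ} (hs : 1 ≤ s) (n m : ℕ) :
    (p : R) ^ s ∣ b (n + m * p ^ s) * b (n / p) - b n * b (n / p + m * p ^ (s - 1)) := by
  have hp0 : 0 < p := by omega
  -- `n = w + p u` with `w = n mod p`, `u = ⌊n/p⌋`; `v = u + m p^{s-1} ≡ u mod p^{s-1}`
  have h := prefixCongr_of_blockRecursion hp hrec hc s hs 1 (n % p) (n / p + m * p ^ (s - 1)) (n / p)
    (by simpa using Nat.mod_lt n hp0) (by simp [Nat.ModEq])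
  have e1 : n % p + p ^ 1 * (n / p + m * p ^ (s - 1)) = n + m * p ^ s := by
    obtain ⟨t, rfl⟩ : ∃ t, s = t + 1 := ⟨s - 1, by omega⟩
    rw [Nat.add_sub_cancel, pow_one, mul_add, ← add_assoc, Nat.mod_add_div, pow_succ]; ring
  have e2 : n % p + p ^ 1 * (n / p) = n := by rw [pow_one, Nat.mod_add_div]
  rw [e1, e2] at h
  exact h

end BlockRecursion

end Literature.NumberTheory.Congruences.DworkCongruences
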